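import Summits.HodgeConjecture.HodgeConjecture.Theorems.F0LD2LineComplementaryOfDisjoint
import Literature.NumberTheory.GelbartRogawski1991.LocalSplittingCMThetaCentreDoublingLines
import Literature.NumberTheory.GelbartRogawski1991.LocalSplittingCMGaloisTransportUndoubled
import HarnessLib

/-!
# LD2 soft-road junction, stub (π2-J): «KUDLA LINES DISJOINT ⟹ COINVARIANT DISJOINTNESS OF THE LETTER'S LINE CARRIERS» — the transport
# from the rank-one CM packages `ω_T ∘ s_T` of Kudla's lines to the letter's transported δ-model line carriers (theorems only)

Cell `hodgecm-mathlib` (D-0151), half A line LD2 (leaf `Cruxes/HLiu418/Lines/F0_P6LD_StubS1bFactsOrganRoad.lean` ED. 7, organ stub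
`stub_organ_lineTypes₁ : LineThetaTypesComplementary₁`, books row #188), seat B-p04 (g45), 2026-09-02; LD2-plan (g3) junction skeleton
`LTC1.softroad.junction.skeleton.v1` (sha16 0547cc77bc6ebf26), stub **(π2-J) `stub_kudlaLinesDisjoint_to_coinvDisjoint₁ : KudlaLinesDisjoint →
CoinvDisjoint₁`**.  THEOREMS ONLY (no `def`, no named fact, no instance, no notation, no `sorry`); `--supports stmt-HodgeConjecture-24832`.

WHAT IS PROVED.  The two bricks of the junction are spelled out VERBATIM (the junction file is HOME-only at the time of writing, so no name of it is
imported; the closer `stub_kudlaLinesDisjoint_to_coinvDisjoint₁ := coinvDisjoint₁_of_kudlaLinesDisjoint` type-checks by `δ`-unfolding):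
* hypothesis (D) «KUDLA LINES DISJOINT»: for every CM field `L`, non-split `v`, Haar data `μ`, lines `T₁`, `T₂ = αT₁` with `(−α⁻¹, δ²)_v = −1`,
  splitting Hecke character `χ` and centre line `J′`, no open-kernel character of `U(J′)(L⁺_v)` is a type of BOTH `ω_{−T₁} ∘ s_{−T₁} ∘ toNegForm ∘
  (z ↦ z)` and `ω_{T₂} ∘ s_{T₂} ∘ (z ↦ z)` (`s_T = localSplittingCMWith L 1 … T … χ hχ v μ`, Kudla's CM section [Kudla1994, §3]);
* conclusion (C) «COINV DISJOINT₁»: VERBATIM the hypothesis `h` of ★ `F0LD2LineComplementaryOfDisjoint.lineThetaTypesComplementary₁_of_coinv_disjoint`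
  — at a guarded non-split place no open-kernel `ξ` of `U(diag dV₁)(L⁺_v)` has non-zero coinvariants in BOTH same-`λ` transported δ-model line
  carriers `ω_D ∘ lineTransportSection(x) (𝓢_{λ,x})`, `x ∈ {a′, a}`, `D = realDiagonal L dV₁`.
THE TRANSPORT (B-p04 (g44) memo v4 §4 ∕ junction skeleton docstring): at `(L, dV₁, λ, a, a′, v, ξ)` instantiate (D) with `μ := addHaar` on the
Borel σ-algebra (so that `localSplittingCMWith … addHaar` IS ★ `localSplittingCM`, the section of the letter's package by ★
`congrW_undoubledSplittings_cmFinLocalFamily_s`), `T₂ := gram e D (a)` LITERALLY, `T₁ := −gram e D (a′)`, `α := −a a′⁻¹`, `J′ := diag dV₁`,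
`J₂ := reindex e e (diag dV₁ ⊗ₖ (a))`, `J₁′ := reindex e e (diag dV₁ ⊗ₖ (a′))`, `ζ := ξ`.  The carriers are then EQUAL as representations of
`U(diag dV₁)(L⁺_v)` on `𝒮(L⁺_v)`:
* §1 `toNegForm ∘ (z ↦ z·1) = (z ↦ z·1)` (same matrices, ★ `coe_toNegForm`); in rank one `k ↦ k ⊗ 1` IS `z ↦ z·1` (★ `localLineInl_localCenter` + ★
  `localCenter_one_apply`); a `subst` transport of the coinvariant statement along an equality `T = T′` of line Gram matrices (for `−(−G) = G`);
* §2 `omega_lineTransportSection_pkg_eq_localSplittingCM_comp_localCenter`: **`ω_D ∘ lineTransportSection(x) (𝓢_{λ,x}) = (ω_{gram e D (x)} ∘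
  localSplittingCM) ∘ (z ↦ z·1)`** (★ `omega_lineTransportSection` «same operators», ★ `congrW_undoubledSplittings_cmFinLocalFamily_s`, §1);
* §3 `coinvDisjoint₁_of_kudlaLinesDisjoint` — (D) ⟹ (C) (class sign `(a′a⁻¹, δ²)_v = −1` from the guard: ★ `not_isNorm_of_eps_guard`, ★
  `hilbertSymbol_eq_neg_one_of_not_isNorm`, ★ `hilbertSymbol_comm`; `L_v` a field by ★ `isField_localRing_cm_of_forall_smul_eq`), and the organ
  corollary `lineThetaTypesComplementary₁_of_kudlaLinesDisjoint : (D) → LineThetaTypesComplementary₁` (★ π1 by name).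

HONEST LABEL.  Nothing of print is asserted; (D) is NOT proved here (it is the soft road's output (Z) through ★ E3).  HC_CM is proved only modulo the
7 printed citations (2 remaining named inputs: hLiu418 = stmt-HodgeConjecture-24832, h413 = stmt-HodgeConjecture-24833) until rung 0 closes; count-neutral.

## References
* [Kudla1994] S. Kudla, *Splitting metaplectic covers of dual reductive pairs*, Israel J. Math. 87 (1994), §3 Thm. 3.1.
* [MoeglinVignerasWaldspurger1987] C. Mœglin, M.-F. Vignéras, J.-L. Waldspurger, LNM 1291 (1987), Chap. 2 II.1 (A)–(B); Chap. 3 §IV.4.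
* [HarrisKudlaSweet1996] M. Harris, S. Kudla, W. J. Sweet, J. AMS 9 (1996), §1 (1.9)–(1.16), §6 Thm. 6.1.
* [GelbartRogawski1991] S. Gelbart, J. Rogawski, Invent. Math. 105 (1991), §3.1 Prop. 3.1.1 p. 455.
* [Liu2021] Y. Liu, Camb. J. Math. 9 (2021) = arXiv:2102.11518, App. D §D.1 Steps 1–2, Lemma D.1 (4) (p. 126).
* [Omeara1963] O. T. O'Meara, *Introduction to Quadratic Forms* (1963), §63B (63:10).
-/

set_option autoImplicit false
set_option linter.dupNamespace false

noncomputable section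

open scoped Matrix Kronecker
open NumberField IsDedekindDomain MeasureTheory
open Literature.NumberTheory Literature.NumberTheory.Automorphic Literature.NumberTheory.Automorphic.UnitaryGroup
open Literature.RepresentationTheory Literature.RepresentationTheory.HeisenbergGroup Literature.RepresentationTheory.TwistedCoinv
open Literature.NumberTheory.GelbartRogawski1991 Literature.NumberTheory.GelbartRogawski1991.UnitaryDualPair
open Literature.NumberTheory.GelbartRogawski1991.UnitaryDualPair.WeilCoinv
open Literature.NumberTheory.GelbartRogawski1991.UnitaryDualPair.LocalSplitting
open Literature.NumberTheory.GelbartRogawski1991.GRConstruction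
open Literature.NumberTheory.Weil1964
open Literature.NumberTheory.GaloisRepresentations Literature.RepresentationTheory.HarrisKudlaSweet1996
open Literature.NumberTheory.Automorphic.IdeleClassGroup Literature.RepresentationTheory.Liu2021
open Literature.NumberTheory.Automorphic.Liu2021 Literature.NumberTheory.Automorphic.Liu2021.Def411WeilCarriers
open Literature.NumberTheory.Automorphic.Liu2021.Def411WeilCarriersDoubling
open Literature.NumberTheory.Automorphic.Liu2021.LemD1RankTwoCMLetters
open Literature.RepresentationTheory.MoeglinVignerasWaldspurger1987
open Literature.NumberTheory.QuadraticForms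
open Summit.HodgeConjecture.HodgeConjecture.Cruxes.HLiu418.F0LD2LineThetaTypesComplementaryDefs
open Summit.HodgeConjecture.HodgeConjecture.Cruxes.HLiu418.F0LD2LineComplementaryOfDisjoint

namespace Summit.HodgeConjecture.HodgeConjecture.Cruxes.HLiu418.F0LD2KudlaLinesToCoinvDisjoint

/-! ## §1 Three identities of presentations of the torus `L_v¹` -/

section Generic

variable (F E : Type) [Field F] [NumberField F] [Field E] [NumberField E] [Algebra F E] [Algebra.IsQuadraticExtension F E]
  (c : E ≃ₐ[F] E) (v : HeightOneSpectrum (𝓞 F))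

omit [Algebra.IsQuadraticExtension F E] in
/-- **`toNegForm ∘ (z ↦ z·1) = (z ↦ z·1)`**: the identity `U(T) ≃ U(−T)` on matrices composed with the centre presentation `U(J₀) → U(T ⊗ 1)` is the
centre presentation `U(J₀) → U(−T ⊗ 1)` (all three are `z ↦ z·1` on the underlying families). [cite: Kudla1994, §2] -/
theorem toNegForm_comp_localCenter {n : ℕ} {T₀ : Matrix (Fin n) (Fin n) F} {J J' : Matrix (Fin n) (Fin n) E}
    (hJ : J = T₀.map (algebraMap F E)) (hJ' : J' = (-T₀).map (algebraMap F E)) {J₀ : Matrix (Fin 1) (Fin 1) E} (hJ₀ : J₀ 0 0 ≠ 0) :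
    (toNegForm F E c v n hJ hJ').toMonoidHom.comp (localCenter E c n J J₀ hJ₀ v) = localCenter E c n J' J₀ hJ₀ v :=
  MonoidHom.ext fun z => Subtype.ext (by
    rw [MonoidHom.comp_apply, MulEquiv.coe_toMonoidHom, coe_toNegForm, coe_localCenter, coe_localCenter])

omit [Algebra.IsQuadraticExtension F E] in
/-- **in rank one `k ↦ k ⊗ 1` IS the centre presentation `z ↦ z·1`** of `U(J_V ⊗ J_W)(F_v)` by the line `J_V` itself (★ `localLineInl_localCenter` at the
identity presentation ★ `localCenter_one_apply`). [cite: GelbartRogawski1991, §3.2 p. 457] -/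
theorem localLineInl_eq_localCenter {n : ℕ} (e : Fin 1 × Fin 1 ≃ Fin n) (JV JW : Matrix (Fin 1) (Fin 1) E) (hJV0 : JV 0 0 ≠ 0)
    (g : localPi E c 1 JV v) :
    localLineInl E c 1 e JV JW v g = localCenter E c n (Matrix.reindex e e (JV ⊗ₖ JW)) JV hJV0 v g := by
  conv_lhs => rw [← localCenter_one_apply E c JV hJV0 v g]
  exact localLineInl_localCenter E c 1 e JV JW JV hJV0 v g

end Generic

section Transport

variable (L : Type) [Field L] [NumberField L] [IsCMField L] (v : HeightOneSpectrum (𝓞 (maximalRealSubfield L)))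
  [MeasurableSpace (v.adicCompletion (maximalRealSubfield L))] [BorelSpace (v.adicCompletion (maximalRealSubfield L))]
  (μ : Measure (v.adicCompletion (maximalRealSubfield L))) [μ.IsAddHaarMeasure]

/-- **transport of «`ζ` is a type of `ω_T ∘ s_T ∘ φ`» along an equality of line Gram matrices `T = T′`** (same hermitian matrix `J`; the symmetry ∕
determinant witnesses are propositions): used for `−(−G) = G`. [cite: Kudla1994, §3 Thm. 3.1] -/
theorem nontrivial_coinv_localSplittingCMWith_iff_of_eq {T T' : Matrix (Fin 1) (Fin 1) (maximalRealSubfield L)} (hTT : T = T')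
    (hT : T.IsSymm) (hTd : IsUnit T.det) (hT' : T'.IsSymm) (hT'd : IsUnit T'.det) {J : Matrix (Fin 1) (Fin 1) L}
    (hJ : J = T.map (algebraMap (maximalRealSubfield L) L)) (hJ' : J = T'.map (algebraMap (maximalRealSubfield L) L))
    (χ : HeckeCharacter L) (hχ : IsSplittingChar L 1 χ) {K : Type*} [Group K]
    (φ : K →* localPi L (IsCMField.complexConj L) 1 J v) (ζ : K →* ℂˣ) :
    Nontrivial (Coinv ((((MpPsi.toRep (localSchrodinger (maximalRealSubfield L) 1 T v)).comp
        (localSplittingCMWith L 1 hT hTd hJ χ hχ v μ))).comp φ) ζ) ↔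
      Nontrivial (Coinv ((((MpPsi.toRep (localSchrodinger (maximalRealSubfield L) 1 T' v)).comp
        (localSplittingCMWith L 1 hT' hT'd hJ' χ hχ v μ))).comp φ) ζ) := by
  subst hTT
  exact Iff.rfl

end Transport

/-! ## §2 The letter's transported δ-model line carrier IS Kudla's CM line package read through `z ↦ z·1` -/

section Carrier

variable (L : Type) [Field L] [NumberField L] [IsCMField L]
  (dV₁ : Fin 1 → L) (hdV₁ : ∀ i, IsCMField.complexConj L (dV₁ i) = dV₁ i) (hdV0₁ : ∀ i, dV₁ i ≠ 0)
  (lam : Literature.NumberTheory.Automorphic.IdeleClassGroup L →ₜ* Circle) (hlam : IsConjugateSymplectic L lam)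
  (x : (↥(maximalRealSubfield L))ˣ) (v : HeightOneSpectrum (𝓞 ↥(maximalRealSubfield L)))

omit [NumberField L] [IsCMField L] in
include hdV0₁ in
/-- `(diag dV₁) 0 0 = dV₁ 0 ≠ 0`: the frame line presents the centre. [folklore] -/
theorem diagonal_apply_zero_ne_zero : Matrix.diagonal dV₁ 0 0 ≠ 0 := by
  rw [Matrix.diagonal_apply_eq]
  exact hdV0₁ 0

set_option synthInstance.maxHeartbeats 400000 in
set_option maxHeartbeats 4000000 in -- the CM θ-package section terms (as ★ `F0LD2LineComplementaryOfDisjoint` §3, 4 M)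
/-- **THE CARRIER IDENTITY.**  For the letter's line `x ∈ (L⁺)ˣ` over the rank-one frame `D = realDiagonal L dV₁`, the transported δ-model carrier
`ω_D ∘ lineTransportSection(x) ((𝓢_{λ,x}).s v)` of `U(diag dV₁)(L⁺_v)` on `𝒮(L⁺_v)` EQUALS Kudla's rank-one CM package `ω_{gram e D (x)} ∘ localSplittingCM`
of the line `gram e D (x) = x·D` composed with the centre presentation `z ↦ z·1 : U(diag dV₁) → U(diag dV₁ ⊗ (x))` — ★ `omega_lineTransportSection`
(«the Weil operators are unchanged»), ★ `congrW_undoubledSplittings_cmFinLocalFamily_s` (the package section IS `localSplittingCM`), §1.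
[cite: MoeglinVignerasWaldspurger1987, Chap. 2 II.1 (A)–(B)] [cite: GelbartRogawski1991, §3.1 Prop. 3.1.1 p. 455] [cite: Liu2021, App. D §D.1 Steps 1–2] -/
theorem omega_lineTransportSection_pkg_eq_localSplittingCM_comp_localCenter :
    (MpPsi.toRep (localSchrodinger (Fp L) 1 (realDiagonal L dV₁ hdV₁) v)).comp
        (lineTransportSection (Fp L) L (IsCMField.complexConj L) 1 (complexConj_imagUnit L) (imagUnit_ne_zero L) (imagUnit_mul_self L) (realDiagonal L dV₁ hdV₁) (realDiagonal_isSymm L dV₁ hdV₁) (Matrix.diagonal dV₁) (realDiagonal_map L dV₁ hdV₁).symm x v ((congrW L (Equiv.prodUnique (Fin 1) (Fin 1)) dV₁ hdV₁ (lineW L (TW (Fp L) x)) (complexConj_lineW L (TW (Fp L) x)) (realDiagonal_lineW L (TW (Fp L) x)) (diagonal_lineW L (TW (Fp L) x) (JW_eq (Fp L) L x)) (undoubledSplittings L (Equiv.prodUnique (Fin 1) (Fin 1)) dV₁ hdV₁ hdV0₁ (lineW L (TW (Fp L) x)) (complexConj_lineW L (TW (Fp L) x)) (lineW_ne_zero L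 (TW (Fp L) x) (isUnit_det_TW (Fp L) x)) (toHeckeCharacter L lam) (borelPlaceMeasure L) (cmFinLocalFamily L (Equiv.prodUnique (Fin 1) (Fin 1)) dV₁ hdV₁ hdV0₁ (lineW L (TW (Fp L) x)) (complexConj_lineW L (TW (Fp L) x)) (lineW_ne_zero L (TW (Fp L) x) (isUnit_det_TW (Fp L) x)) (toHeckeCharacter L lam) ((isOscillatorChar_toHeckeCharacter_iff lam).mpr hlam) (borelPlaceMeasure L))) (isSymm_TW (Fp L) x) (JW_eq (Fp L) L x)).s v) ((congrW L (Equiv.prodUnique (Fin 1) (Fin 1)) dV₁ hdV₁ (lineW L (TW (Fp L) x)) (complexConj_lineW L (TW (Fp L) x)) (realDiagonal_lineW L (TW (Fp L) x)) (diagonal_lineW L (TW (Fp L) x) (JW_eq (Fp L) L x)) (undoubledSplittings L (Equiv.prodUnique (Fin 1) (Fin 1)) dV₁ hdV₁ hdV0₁ (lineW L (TW (Fp L) x)) (complexConj_lineW L (TW (Fp L) x)) (lineW_ne_zero L (TW (Fp L) x) (isUnit_det_TW (Fp L) x)) (toHeckeCharacter L lam) (borelPlaceMeasure L) (cmFinLocalFamily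 L (Equiv.prodUnique (Fin 1) (Fin 1)) dV₁ hdV₁ hdV0₁ (lineW L (TW (Fp L) x)) (complexConj_lineW L (TW (Fp L) x)) (lineW_ne_zero L (TW (Fp L) x) (isUnit_det_TW (Fp L) x)) (toHeckeCharacter L lam) ((isOscillatorChar_toHeckeCharacter_iff lam).mpr hlam) (borelPlaceMeasure L))) (isSymm_TW (Fp L) x) (JW_eq (Fp L) L x)).proj_s v)) =
      (show Representation ℂ (localPi L (IsCMField.complexConj L) 1 (Matrix.diagonal dV₁) v) (SchwartzBruhat (Fin 1 → v.adicCompletion (Fp L))) from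
        ((MpPsi.toRep (localSchrodinger (Fp L) 1 (gram (Fp L) (Equiv.prodUnique (Fin 1) (Fin 1)) (realDiagonal L dV₁ hdV₁) (TW (Fp L) x)) v)).comp
          (localSplittingCM L 1 (isSymm_gram (Fp L) (Equiv.prodUnique (Fin 1) (Fin 1)) (realDiagonal_isSymm L dV₁ hdV₁) (isSymm_TW (Fp L) x))
            (isUnit_det_gram (Fp L) (Equiv.prodUnique (Fin 1) (Fin 1)) (isUnit_det_realDiagonal L dV₁ hdV₁ hdV0₁) (isUnit_det_TW (Fp L) x))
            (reindex_kronecker_eq_gram_map (Fp L) L (Equiv.prodUnique (Fin 1) (Fin 1)) (realDiagonal_map L dV₁ hdV₁).symm (JW_eq (Fp L) L x))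
            (toHeckeCharacter L lam) ((isOscillatorChar_toHeckeCharacter_iff lam).mpr hlam) v)).comp
          (localCenter L (IsCMField.complexConj L) 1
            (Matrix.reindex (Equiv.prodUnique (Fin 1) (Fin 1)) (Equiv.prodUnique (Fin 1) (Fin 1)) (Matrix.diagonal dV₁ ⊗ₖ JW (Fp L) L x))
            (Matrix.diagonal dV₁) (diagonal_apply_zero_ne_zero L dV₁ hdV0₁) v)) := by
  rw [omega_lineTransportSection,
    Literature.NumberTheory.GelbartRogawski1991.UnitaryDualPair.LocalSplitting.congrW_undoubledSplittings_cmFinLocalFamily_s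
      (hW'd := isUnit_det_TW (Fp L) x)]
  refine MonoidHom.ext fun g => ?_
  change MpPsi.toRep _ (localSplittingCM L 1 _ _ _ (toHeckeCharacter L lam) _ v
      (localLineInl L (IsCMField.complexConj L) 1 (Equiv.prodUnique (Fin 1) (Fin 1)) (Matrix.diagonal dV₁) (JW (Fp L) L x) v g)) =
    MpPsi.toRep _ (localSplittingCM L 1 _ _ _ (toHeckeCharacter L lam) _ v
      (localCenter L (IsCMField.complexConj L) 1
        (Matrix.reindex (Equiv.prodUnique (Fin 1) (Fin 1)) (Equiv.prodUnique (Fin 1) (Fin 1)) (Matrix.diagonal dV₁ ⊗ₖ JW (Fp L) L x))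
        (Matrix.diagonal dV₁) (diagonal_apply_zero_ne_zero L dV₁ hdV0₁) v g))
  rw [localLineInl_eq_localCenter (Fp L) L (IsCMField.complexConj L) v (Equiv.prodUnique (Fin 1) (Fin 1)) (Matrix.diagonal dV₁) (JW (Fp L) L x)
    (diagonal_apply_zero_ne_zero L dV₁ hdV0₁) g]

end Carrier

/-! ## §3 (D) ⟹ (C): Kudla-lines disjointness gives the coinvariant disjointness of the letter's carriers -/

set_option synthInstance.maxHeartbeats 400000 in
set_option maxHeartbeats 8000000 in -- two bricks spelled in full + the CM θ-package section terms
/-- **(π2-J) THE TRANSPORT `KudlaLinesDisjoint → CoinvDisjoint₁`** (both bricks of LD2-plan (g3)'s junction spelled out verbatim): if for every anisotropic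
plane of two lines `T₁`, `T₂ = αT₁` (`(−α⁻¹, δ²)_v = −1`) at a non-split `v` the rank-one CM packages of `−T₁` (through `toNegForm`) and `T₂` have disjoint
type sets, then at every guarded non-split place the letter's two same-`λ` transported δ-model line carriers have no common open-kernel coinvariant type —
instantiate at `T₂ := gram e D (a)`, `T₁ := −gram e D (a′)`, `α := −a a′⁻¹`, `μ := addHaar`, `J′ := diag dV₁`, `ζ := ξ`, and identify the carriers by §2
(a-side) and §2 + §1 (a′-side, `−(−G) = G`). [cite: Kudla1994, §3 Thm. 3.1] [cite: HarrisKudlaSweet1996, §6 Thm. 6.1]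
[cite: MoeglinVignerasWaldspurger1987, Chap. 3 §IV.4] [cite: Liu2021, App. D Lemma D.1 (4) (p. 126)] -/
theorem coinvDisjoint₁_of_kudlaLinesDisjoint
    (hD : ∀ (L : Type) [Field L] [NumberField L] [IsCMField L] (v : HeightOneSpectrum (𝓞 (maximalRealSubfield L)))
    [MeasurableSpace (v.adicCompletion (maximalRealSubfield L))] [BorelSpace (v.adicCompletion (maximalRealSubfield L))]
    (μ : Measure (v.adicCompletion (maximalRealSubfield L))) [μ.IsAddHaarMeasure]
    (hE : IsField (UnitaryGroup.LocalRing L v))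
    {T₁ T₂ : Matrix (Fin 1) (Fin 1) (maximalRealSubfield L)} (hT₁ : T₁.IsSymm) (hT₂ : T₂.IsSymm) (hT₁d : IsUnit T₁.det) (hT₂d : IsUnit T₂.det)
    (α : (maximalRealSubfield L)ˣ) (hTT' : T₂ = (α : maximalRealSubfield L) • T₁)
    (hclass : hilbertSymbol (v.adicCompletion (maximalRealSubfield L))
      ((-(α : maximalRealSubfield L)⁻¹ : maximalRealSubfield L) : v.adicCompletion (maximalRealSubfield L))
      ((imagUnitSq L : maximalRealSubfield L) : v.adicCompletion (maximalRealSubfield L)) = -1)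
    {T : Matrix (Fin (1 + 1)) (Fin (1 + 1)) (maximalRealSubfield L)} (hT : T = UnitaryGroup.finSum 1 1 T₁ T₂) (hTs : T.IsSymm) (hTd : IsUnit T.det)
    {J₁ : Matrix (Fin 1) (Fin 1) L} (hJ₁ : J₁ = T₁.map (algebraMap (maximalRealSubfield L) L))
    {J₁' : Matrix (Fin 1) (Fin 1) L} (hJ₁' : J₁' = (-T₁).map (algebraMap (maximalRealSubfield L) L))
    {J₂ : Matrix (Fin 1) (Fin 1) L} (hJ₂ : J₂ = T₂.map (algebraMap (maximalRealSubfield L) L))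
    {J : Matrix (Fin (1 + 1)) (Fin (1 + 1)) L} (hJ : J = T.map (algebraMap (maximalRealSubfield L) L))
    (χ : HeckeCharacter L) (hχ : IsSplittingChar L 1 χ) {J' : Matrix (Fin 1) (Fin 1) L} (hJ'0 : J' 0 0 ≠ 0),
    ∀ ζ : localPi L (IsCMField.complexConj L) 1 J' v →* ℂˣ, IsOpen (ζ.ker : Set (localPi L (IsCMField.complexConj L) 1 J' v)) →
      Nontrivial (Coinv ((((MpPsi.toRep (localSchrodinger (maximalRealSubfield L) 1 (-T₁) v)).comp
        (localSplittingCMWith L 1 hT₁.neg (isUnit_det_neg_of_isUnit (maximalRealSubfield L) 1 hT₁d) hJ₁' χ hχ v μ))).comp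
        ((toNegForm (maximalRealSubfield L) L (IsCMField.complexConj L) v 1 hJ₁ hJ₁').toMonoidHom.comp
          (UnitaryGroup.localCenter L (IsCMField.complexConj L) 1 J₁ J' hJ'0 v))) ζ) →
      ¬ Nontrivial (Coinv ((((MpPsi.toRep (localSchrodinger (maximalRealSubfield L) 1 T₂ v)).comp
        (localSplittingCMWith L 1 hT₂ hT₂d hJ₂ χ hχ v μ))).comp
        (UnitaryGroup.localCenter L (IsCMField.complexConj L) 1 J₂ J' hJ'0 v)) ζ)) :
    ∀ (L : Type) [Field L] [NumberField L] [IsCMField L]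
    (dV₁ : Fin 1 → L) (hdV₁ : ∀ i, IsCMField.complexConj L (dV₁ i) = dV₁ i) (hdV0₁ : ∀ i, dV₁ i ≠ 0)
    (lam : Literature.NumberTheory.Automorphic.IdeleClassGroup L →ₜ* Circle) (hlam : IsConjugateSymplectic L lam)
    (a a' : (↥(maximalRealSubfield L))ˣ) (v : HeightOneSpectrum (𝓞 ↥(maximalRealSubfield L))),
    (∀ w : UnitaryGroup.PlacesOver L v, IsCMField.complexConj L • (w : HeightOneSpectrum (𝓞 L)) = w) →
    (¬ ∃ x : (LocalRing L v)ˣ, LemD1OfPlace.eps L v (lineDelta_ne_zero (imagUnit_ne_zero L) a) =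
        x * Units.map (conjLocal L (IsCMField.complexConj L) v : LocalRing L v →* LocalRing L v) x *
          LemD1OfPlace.eps L v (lineDelta_ne_zero (imagUnit_ne_zero L) a')) →
    ∀ ξ : (localPi L (IsCMField.complexConj L) 1 (Matrix.diagonal dV₁) v) →* ℂˣ,
      IsOpen (ξ.ker : Set (localPi L (IsCMField.complexConj L) 1 (Matrix.diagonal dV₁) v)) →
      Nontrivial (TwistedCoinv.Coinv ((MpPsi.toRep (localSchrodinger (Fp L) 1 (realDiagonal L dV₁ hdV₁) v)).comp
          (lineTransportSection (Fp L) L (IsCMField.complexConj L) 1 (complexConj_imagUnit L) (imagUnit_ne_zero L) (imagUnit_mul_self L) (realDiagonal L dV₁ hdV₁) (realDiagonal_isSymm L dV₁ hdV₁) (Matrix.diagonal dV₁) (realDiagonal_map L dV₁ hdV₁).symm a' v ((congrW L (Equiv.prodUnique (Fin 1) (Fin 1)) dV₁ hdV₁ (lineW L (TW (Fp L) a')) (complexConj_lineW L (TW (Fp L) a')) (realDiagonal_lineW L (TW (Fp L) a')) (diagonal_lineW L (TW (Fp L) a') (JW_eq (Fp L) L a')) (undoubledSplittings L (Equiv.prodUnique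 (Fin 1) (Fin 1)) dV₁ hdV₁ hdV0₁ (lineW L (TW (Fp L) a')) (complexConj_lineW L (TW (Fp L) a')) (lineW_ne_zero L (TW (Fp L) a') (isUnit_det_TW (Fp L) a')) (toHeckeCharacter L lam) (borelPlaceMeasure L) (cmFinLocalFamily L (Equiv.prodUnique (Fin 1) (Fin 1)) dV₁ hdV₁ hdV0₁ (lineW L (TW (Fp L) a')) (complexConj_lineW L (TW (Fp L) a')) (lineW_ne_zero L (TW (Fp L) a') (isUnit_det_TW (Fp L) a')) (toHeckeCharacter L lam) ((isOscillatorChar_toHeckeCharacter_iff lam).mpr hlam) (borelPlaceMeasure L))) (isSymm_TW (Fp L) a') (JW_eq (Fp L) L a')).s v) ((congrW L (Equiv.prodUnique (Fin 1) (Fin 1)) dV₁ hdV₁ (lineW L (TW (Fp L) a')) (complexConj_lineW L (TW (Fp L) a')) (realDiagonal_lineW L (TW (Fp L) a')) (diagonal_lineW L (TW (Fp L) a') (JW_eq (Fp L) L a')) (undoubledSplittings L (Equiv.prodUnique (Fin 1) (Fin 1)) dV₁ hdV₁ hdV0₁ (lineW L (TW (Fp L) a')) (complexConj_lineW L (TW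 (Fp L) a')) (lineW_ne_zero L (TW (Fp L) a') (isUnit_det_TW (Fp L) a')) (toHeckeCharacter L lam) (borelPlaceMeasure L) (cmFinLocalFamily L (Equiv.prodUnique (Fin 1) (Fin 1)) dV₁ hdV₁ hdV0₁ (lineW L (TW (Fp L) a')) (complexConj_lineW L (TW (Fp L) a')) (lineW_ne_zero L (TW (Fp L) a') (isUnit_det_TW (Fp L) a')) (toHeckeCharacter L lam) ((isOscillatorChar_toHeckeCharacter_iff lam).mpr hlam) (borelPlaceMeasure L))) (isSymm_TW (Fp L) a') (JW_eq (Fp L) L a')).proj_s v))) ξ) →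
        Nontrivial (TwistedCoinv.Coinv ((MpPsi.toRep (localSchrodinger (Fp L) 1 (realDiagonal L dV₁ hdV₁) v)).comp
          (lineTransportSection (Fp L) L (IsCMField.complexConj L) 1 (complexConj_imagUnit L) (imagUnit_ne_zero L) (imagUnit_mul_self L) (realDiagonal L dV₁ hdV₁) (realDiagonal_isSymm L dV₁ hdV₁) (Matrix.diagonal dV₁) (realDiagonal_map L dV₁ hdV₁).symm a v ((congrW L (Equiv.prodUnique (Fin 1) (Fin 1)) dV₁ hdV₁ (lineW L (TW (Fp L) a)) (complexConj_lineW L (TW (Fp L) a)) (realDiagonal_lineW L (TW (Fp L) a)) (diagonal_lineW L (TW (Fp L) a) (JW_eq (Fp L) L a)) (undoubledSplittings L (Equiv.prodUnique (Fin 1) (Fin 1)) dV₁ hdV₁ hdV0₁ (lineW L (TW (Fp L) a)) (complexConj_lineW L (TW (Fp L) a)) (lineW_ne_zero L (TW (Fp L) a) (isUnit_det_TW (Fp L) a)) (toHeckeCharacter L lam) (borelPlaceMeasure L) (cmFinLocalFamily L (Equiv.prodUnique (Fin 1) (Fin 1)) dV₁ hdV₁ hdV0₁ (lineW L (TW (Fp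 L) a)) (complexConj_lineW L (TW (Fp L) a)) (lineW_ne_zero L (TW (Fp L) a) (isUnit_det_TW (Fp L) a)) (toHeckeCharacter L lam) ((isOscillatorChar_toHeckeCharacter_iff lam).mpr hlam) (borelPlaceMeasure L))) (isSymm_TW (Fp L) a) (JW_eq (Fp L) L a)).s v) ((congrW L (Equiv.prodUnique (Fin 1) (Fin 1)) dV₁ hdV₁ (lineW L (TW (Fp L) a)) (complexConj_lineW L (TW (Fp L) a)) (realDiagonal_lineW L (TW (Fp L) a)) (diagonal_lineW L (TW (Fp L) a) (JW_eq (Fp L) L a)) (undoubledSplittings L (Equiv.prodUnique (Fin 1) (Fin 1)) dV₁ hdV₁ hdV0₁ (lineW L (TW (Fp L) a)) (complexConj_lineW L (TW (Fp L) a)) (lineW_ne_zero L (TW (Fp L) a) (isUnit_det_TW (Fp L) a)) (toHeckeCharacter L lam) (borelPlaceMeasure L) (cmFinLocalFamily L (Equiv.prodUnique (Fin 1) (Fin 1)) dV₁ hdV₁ hdV0₁ (lineW L (TW (Fp L) a)) (complexConj_lineW L (TW (Fp L) a)) (lineW_ne_zero L (TW (Fp L) a) (isUnit_det_TW (Fp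 L) a)) (toHeckeCharacter L lam) ((isOscillatorChar_toHeckeCharacter_iff lam).mpr hlam) (borelPlaceMeasure L))) (isSymm_TW (Fp L) a) (JW_eq (Fp L) L a)).proj_s v))) ξ) → False := by
  intro L _ _ _ dV₁ hdV₁ hdV0₁ lam hlam a a' v hns hg ξ hξ h₁ h₂
  -- Haar data: the Borel σ-algebra and Mathlib's additive Haar measure, so that `localSplittingCMWith … addHaar` IS `localSplittingCM`
  letI : MeasurableSpace (v.adicCompletion (Fp L)) := borel _
  haveI : BorelSpace (v.adicCompletion (Fp L)) := ⟨rfl⟩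
  have hE : IsField (UnitaryGroup.LocalRing L v) := isField_localRing_cm_of_forall_smul_eq L v hns
  -- the class sign `(a⁻¹a′, δ²)_v = −1` from the guard
  have hN := not_isNorm_of_eps_guard (Fp L) L (IsCMField.complexConj L) (imagUnit_ne_zero L) v a a' hg
  have hcls := _root_.Summit.HodgeConjecture.HodgeConjecture.Cruxes.H413.F0P2oU1DichotomyTransport.hilbertSymbol_eq_neg_one_of_not_isNorm
    (Fp L) L (IsCMField.complexConj L)
    (complexConj_imagUnit L) (imagUnit_ne_zero L) (imagUnit_mul_self L) v hE (a⁻¹ * a').ne_zero hN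
  -- names for the two line Gram matrices `G = gram e D (a) = a·D`, `G′ = gram e D (a′) = a′·D` and their witnesses
  set D : Matrix (Fin 1) (Fin 1) (Fp L) := realDiagonal L dV₁ hdV₁ with hDdef
  have hDs : D.IsSymm := realDiagonal_isSymm L dV₁ hdV₁
  have hDd : IsUnit D.det := isUnit_det_realDiagonal L dV₁ hdV₁ hdV0₁
  have hGs : (gram (Fp L) (Equiv.prodUnique (Fin 1) (Fin 1)) D (TW (Fp L) a)).IsSymm :=
    isSymm_gram (Fp L) (Equiv.prodUnique (Fin 1) (Fin 1)) hDs (isSymm_TW (Fp L) a)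
  have hGd : IsUnit (gram (Fp L) (Equiv.prodUnique (Fin 1) (Fin 1)) D (TW (Fp L) a)).det :=
    isUnit_det_gram (Fp L) (Equiv.prodUnique (Fin 1) (Fin 1)) hDd (isUnit_det_TW (Fp L) a)
  have hG's : (gram (Fp L) (Equiv.prodUnique (Fin 1) (Fin 1)) D (TW (Fp L) a')).IsSymm :=
    isSymm_gram (Fp L) (Equiv.prodUnique (Fin 1) (Fin 1)) hDs (isSymm_TW (Fp L) a')
  have hG'd : IsUnit (gram (Fp L) (Equiv.prodUnique (Fin 1) (Fin 1)) D (TW (Fp L) a')).det :=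
    isUnit_det_gram (Fp L) (Equiv.prodUnique (Fin 1) (Fin 1)) hDd (isUnit_det_TW (Fp L) a')
  have hJ₂ : Matrix.reindex (Equiv.prodUnique (Fin 1) (Fin 1)) (Equiv.prodUnique (Fin 1) (Fin 1)) (Matrix.diagonal dV₁ ⊗ₖ JW (Fp L) L a) =
      (gram (Fp L) (Equiv.prodUnique (Fin 1) (Fin 1)) D (TW (Fp L) a)).map (algebraMap (Fp L) L) :=
    reindex_kronecker_eq_gram_map (Fp L) L (Equiv.prodUnique (Fin 1) (Fin 1)) (realDiagonal_map L dV₁ hdV₁).symm (JW_eq (Fp L) L a)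
  have hJ₁'G : Matrix.reindex (Equiv.prodUnique (Fin 1) (Fin 1)) (Equiv.prodUnique (Fin 1) (Fin 1)) (Matrix.diagonal dV₁ ⊗ₖ JW (Fp L) L a') =
      (gram (Fp L) (Equiv.prodUnique (Fin 1) (Fin 1)) D (TW (Fp L) a')).map (algebraMap (Fp L) L) :=
    reindex_kronecker_eq_gram_map (Fp L) L (Equiv.prodUnique (Fin 1) (Fin 1)) (realDiagonal_map L dV₁ hdV₁).symm (JW_eq (Fp L) L a')
  have hJ₁' : Matrix.reindex (Equiv.prodUnique (Fin 1) (Fin 1)) (Equiv.prodUnique (Fin 1) (Fin 1)) (Matrix.diagonal dV₁ ⊗ₖ JW (Fp L) L a') =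
      (-(-gram (Fp L) (Equiv.prodUnique (Fin 1) (Fin 1)) D (TW (Fp L) a'))).map (algebraMap (Fp L) L) := by
    rw [neg_neg]; exact hJ₁'G
  -- the scaling `T₂ = α • T₁` with `α = −a a′⁻¹`
  have hGa : gram (Fp L) (Equiv.prodUnique (Fin 1) (Fin 1)) D (TW (Fp L) a) = (a : Fp L) • D := gram_prodUnique_TW (Fp L) 1 a D
  have hGa' : gram (Fp L) (Equiv.prodUnique (Fin 1) (Fin 1)) D (TW (Fp L) a') = (a' : Fp L) • D := gram_prodUnique_TW (Fp L) 1 a' D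
  have hTT' : gram (Fp L) (Equiv.prodUnique (Fin 1) (Fin 1)) D (TW (Fp L) a) =
      ((-(a * a'⁻¹) : (Fp L)ˣ) : Fp L) • (-gram (Fp L) (Equiv.prodUnique (Fin 1) (Fin 1)) D (TW (Fp L) a')) := by
    rw [hGa, hGa', smul_neg, ← neg_smul, smul_smul, Units.val_neg, neg_neg, Units.val_mul, mul_assoc, ← Units.val_mul,
      inv_mul_cancel, Units.val_one, mul_one]
  -- the class sign in the junction's currency `(−α⁻¹, δ²)_v = (a⁻¹a′, δ²)_v = −1`
  have hα : ((-((-(a * a'⁻¹) : (Fp L)ˣ) : Fp L)⁻¹ : Fp L) : v.adicCompletion (Fp L)) =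
      (((a⁻¹ * a' : (Fp L)ˣ) : Fp L) : v.adicCompletion (Fp L)) := by
    congr 1
    rw [Units.val_neg, inv_neg, neg_neg, ← Units.val_inv_eq_inv_val, mul_inv_rev, inv_inv, mul_comm]
  have hclass : hilbertSymbol (v.adicCompletion (Fp L))
      ((-((-(a * a'⁻¹) : (Fp L)ˣ) : Fp L)⁻¹ : Fp L) : v.adicCompletion (Fp L))
      ((imagUnitSq L : Fp L) : v.adicCompletion (Fp L)) = -1 := by
    rw [hα, hilbertSymbol_comm]
    exact hcls
  -- the centre line `J′ := diag dV₁`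
  have hJ'0 : Matrix.diagonal dV₁ 0 0 ≠ 0 := diagonal_apply_zero_ne_zero L dV₁ hdV0₁
  -- (D) instantiated
  have key := hD L v Measure.addHaar hE (T₁ := -gram (Fp L) (Equiv.prodUnique (Fin 1) (Fin 1)) D (TW (Fp L) a'))
    (T₂ := gram (Fp L) (Equiv.prodUnique (Fin 1) (Fin 1)) D (TW (Fp L) a)) hG's.neg hGs
    (isUnit_det_neg_of_isUnit (Fp L) 1 hG'd) hGd (-(a * a'⁻¹)) hTT' hclass rfl
    (UnitaryGroup.isSymm_finSum hG's.neg hGs) (DoubledBlock.isUnit_det_finSum L 1 1 (isUnit_det_neg_of_isUnit (Fp L) 1 hG'd) hGd)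
    (J₁ := (-gram (Fp L) (Equiv.prodUnique (Fin 1) (Fin 1)) D (TW (Fp L) a')).map (algebraMap (Fp L) L)) rfl hJ₁' hJ₂
    (J := (UnitaryGroup.finSum 1 1 (-gram (Fp L) (Equiv.prodUnique (Fin 1) (Fin 1)) D (TW (Fp L) a'))
      (gram (Fp L) (Equiv.prodUnique (Fin 1) (Fin 1)) D (TW (Fp L) a))).map (algebraMap (Fp L) L)) rfl
    (toHeckeCharacter L lam) ((isOscillatorChar_toHeckeCharacter_iff lam).mpr hlam) hJ'0 ξ hξ
  -- the a-side carrier IS the (D)-side second package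
  have ha := omega_lineTransportSection_pkg_eq_localSplittingCM_comp_localCenter L dV₁ hdV₁ hdV0₁ lam hlam a v
  -- the a′-side carrier IS the package of `G′ = −(−G′)` read through `z ↦ z·1`
  have ha' := omega_lineTransportSection_pkg_eq_localSplittingCM_comp_localCenter L dV₁ hdV₁ hdV0₁ lam hlam a' v
  rw [ha'] at h₁
  rw [ha] at h₂
  refine key ?_ h₂
  -- `toNegForm ∘ (z ↦ z·1) = (z ↦ z·1)` and the transport `−(−G′) = G′`
  rw [toNegForm_comp_localCenter]
  exact (nontrivial_coinv_localSplittingCMWith_iff_of_eq L v Measure.addHaar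
    (neg_neg (gram (Fp L) (Equiv.prodUnique (Fin 1) (Fin 1)) D (TW (Fp L) a'))) _ _ hG's hG'd hJ₁' hJ₁'G
    (toHeckeCharacter L lam) ((isOscillatorChar_toHeckeCharacter_iff lam).mpr hlam) _ ξ).mpr h₁

set_option synthInstance.maxHeartbeats 400000 in
set_option maxHeartbeats 8000000 in -- as `coinvDisjoint₁_of_kudlaLinesDisjoint`
/-- **THE ORGAN FROM KUDLA-LINES DISJOINTNESS**: (D) ⟹ ★ `LineThetaTypesComplementary₁` (§3 composed with ★ π1
`lineThetaTypesComplementary₁_of_coinv_disjoint` by name). [cite: MoeglinVignerasWaldspurger1987, Chap. 3 §IV.4 Théorème principal]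
[cite: HarrisKudlaSweet1996, §6 Thm. 6.1] [cite: Liu2021, App. D Lemma D.1 (4) (p. 126)] -/
theorem lineThetaTypesComplementary₁_of_kudlaLinesDisjoint
    (hD : ∀ (L : Type) [Field L] [NumberField L] [IsCMField L] (v : HeightOneSpectrum (𝓞 (maximalRealSubfield L)))
    [MeasurableSpace (v.adicCompletion (maximalRealSubfield L))] [BorelSpace (v.adicCompletion (maximalRealSubfield L))]
    (μ : Measure (v.adicCompletion (maximalRealSubfield L))) [μ.IsAddHaarMeasure]
    (hE : IsField (UnitaryGroup.LocalRing L v))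
    {T₁ T₂ : Matrix (Fin 1) (Fin 1) (maximalRealSubfield L)} (hT₁ : T₁.IsSymm) (hT₂ : T₂.IsSymm) (hT₁d : IsUnit T₁.det) (hT₂d : IsUnit T₂.det)
    (α : (maximalRealSubfield L)ˣ) (hTT' : T₂ = (α : maximalRealSubfield L) • T₁)
    (hclass : hilbertSymbol (v.adicCompletion (maximalRealSubfield L))
      ((-(α : maximalRealSubfield L)⁻¹ : maximalRealSubfield L) : v.adicCompletion (maximalRealSubfield L))
      ((imagUnitSq L : maximalRealSubfield L) : v.adicCompletion (maximalRealSubfield L)) = -1)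
    {T : Matrix (Fin (1 + 1)) (Fin (1 + 1)) (maximalRealSubfield L)} (hT : T = UnitaryGroup.finSum 1 1 T₁ T₂) (hTs : T.IsSymm) (hTd : IsUnit T.det)
    {J₁ : Matrix (Fin 1) (Fin 1) L} (hJ₁ : J₁ = T₁.map (algebraMap (maximalRealSubfield L) L))
    {J₁' : Matrix (Fin 1) (Fin 1) L} (hJ₁' : J₁' = (-T₁).map (algebraMap (maximalRealSubfield L) L))
    {J₂ : Matrix (Fin 1) (Fin 1) L} (hJ₂ : J₂ = T₂.map (algebraMap (maximalRealSubfield L) L))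
    {J : Matrix (Fin (1 + 1)) (Fin (1 + 1)) L} (hJ : J = T.map (algebraMap (maximalRealSubfield L) L))
    (χ : HeckeCharacter L) (hχ : IsSplittingChar L 1 χ) {J' : Matrix (Fin 1) (Fin 1) L} (hJ'0 : J' 0 0 ≠ 0),
    ∀ ζ : localPi L (IsCMField.complexConj L) 1 J' v →* ℂˣ, IsOpen (ζ.ker : Set (localPi L (IsCMField.complexConj L) 1 J' v)) →
      Nontrivial (Coinv ((((MpPsi.toRep (localSchrodinger (maximalRealSubfield L) 1 (-T₁) v)).comp
        (localSplittingCMWith L 1 hT₁.neg (isUnit_det_neg_of_isUnit (maximalRealSubfield L) 1 hT₁d) hJ₁' χ hχ v μ))).comp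
        ((toNegForm (maximalRealSubfield L) L (IsCMField.complexConj L) v 1 hJ₁ hJ₁').toMonoidHom.comp
          (UnitaryGroup.localCenter L (IsCMField.complexConj L) 1 J₁ J' hJ'0 v))) ζ) →
      ¬ Nontrivial (Coinv ((((MpPsi.toRep (localSchrodinger (maximalRealSubfield L) 1 T₂ v)).comp
        (localSplittingCMWith L 1 hT₂ hT₂d hJ₂ χ hχ v μ))).comp
        (UnitaryGroup.localCenter L (IsCMField.complexConj L) 1 J₂ J' hJ'0 v)) ζ)) :
    LineThetaTypesComplementary₁ :=
  lineThetaTypesComplementary₁_of_coinv_disjoint (coinvDisjoint₁_of_kudlaLinesDisjoint hD)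

end Summit.HodgeConjecture.HodgeConjecture.Cruxes.HLiu418.F0LD2KudlaLinesToCoinvDisjoint

end
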